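import Summits.ResolutionOfSingularities.ResolutionOfSingularities.Theorems.EquisingularLiftEquisingularLiftSplit
import Literature.AlgebraicGeometry.Resolution.BlowupsIntegral
import Literature.AlgebraicGeometry.Resolution.NonPrincipalLocus
import HarnessLib

/-!
# [OURS · L1 W4.5(b) · EL♮] STAGES OF AN ITEM CHAIN ARE INTEGRAL AND DOMINATE THE BASE
# (input «L-INJ» of res-D-pv-003's multisection adapter `hMS_of_multisection` for T-TAIL p508794 / T-Δ-ISO p509522)

Crux `EquisingularLiftNat` = stmt-ResolutionOfSingularities-20038 (route EquisingularLift); helper file `--supports … --as helper`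
(res-D-pv-013, CHAIN v7.3 row T-Δ-ISO; contract res-D-pv-003 2026-08-27T07:41:35Z). HONEST FRAMING: OURS; NOT a statement of any
manuscript; scheme-theoretic bookkeeping. AI-written, weaker than expert review. No `sorry`; standard axioms.

* `chain_isIntegral_and_exists_over_genericPoint` — along the item's chain predicate `Split.Chain P Y X' σ S'` (blow-ups along
  regular centres off the generic point of `Y`) starting from an INTEGRAL `P`: every stage `X'` is integral and some point of `X'` maps
  to the generic point of `P`. (Induction along the chain: the next stage carries a point over the generic point of `Y`
  (`Chain.fibre`), so it is non-empty and the centre was not the zero ideal sheaf (a blow-up along `0` is empty); blow-ups of integral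
  schemes along non-zero ideal sheaves are integral (`IsBlowup.isIntegral`, Stacks 02ND); the generic point of the stage maps to the
  generic point of `P` and lies off the centre (`not_mem_support_genericPoint`), where the blow-up is an isomorphism
  (`IsBlowup.isIso_compl`, Stacks 02OS).)
* `chain_exists_apply_ne` — hence, for any `q : P → S` and `s₀` with `q (genericPoint P) ≠ s₀`, some point of the stage maps
  outside `s₀` under `σ ≫ q` (a generic-fibre point, i.e. «horizontality» of the stage over a DVR).

References: The Stacks Project, Tags 02ND, 02OS; Theorems/EquisingularLiftEquisingularLiftSplit.lean (`Chain.fibre`).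
-/

set_option linter.dupNamespace false -- mandated namespace `Summit.<Summit>.<Problem>` of this single-conjunct summit

noncomputable section

open CategoryTheory CategoryTheory.Limits AlgebraicGeometry TopologicalSpace Topology
open Literature.AlgebraicGeometry.Resolution
open AlgebraicGeometry.Scheme.IdealSheafData
open Summit.ResolutionOfSingularities.ResolutionOfSingularities.Theses.EquisingularLift.Split

namespace Summit.ResolutionOfSingularities.ResolutionOfSingularities.Cruxes.EquisingularLiftNat.Sections

/-- **Stages of an item chain over an integral `P` are integral and carry a point over the generic point of `P`.**
[cite: StacksProject, Tag 02ND and Tag 02OS] -/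
theorem chain_isIntegral_and_exists_over_genericPoint {P : Scheme.{0}} [IsIntegral P] {Y : Set P} {ξ : P}
    (hξ : IsGenericPoint ξ Y) {X' : Scheme.{0}} {σ : X' ⟶ P} {S' : Set X'} (h : Chain P Y X' σ S') :
    IsIntegral X' ∧ ∃ x : X', σ x = genericPoint P := by
  have key := h (fun X₁ σ₁ S₁ => Chain P Y X₁ σ₁ S₁ ∧ IsIntegral X₁ ∧ ∃ x : X₁, σ₁ x = genericPoint P) ?_ ?_
  · exact key.2
  · exact ⟨fun Q h0 _ => h0, inferInstance, genericPoint P, rfl⟩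
  · intro X₁ X₂ σ₁ Y₁ C τ hQ hτ hCreg himg
    obtain ⟨hch, hint, x, hx⟩ := hQ
    haveI := hint
    -- the next stage is in the chain, hence non-empty: the centre is not the zero ideal sheaf
    have hch₂ : Chain P Y X₂ (τ ≫ σ₁) (closure (τ ⁻¹' (Y₁ \ (C.support : Set X₁)))) :=
      fun Q h0 hs => hs X₁ X₂ σ₁ Y₁ C τ (hch Q h0 hs) hτ hCreg himg
    obtain ⟨ξ₂, -, -⟩ := Chain.fibre hch₂ hξ
    have hC : C ≠ ⊥ := by
      intro hC
      subst hC
      have hcart := hτ.isEffectiveCartier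
      rw [Scheme.IdealSheafData.comap_bot] at hcart
      obtain ⟨U, hU, f, hf, hfU⟩ := hcart ξ₂
      haveI : Nonempty (U : X₂.Opens) := ⟨⟨ξ₂, hU⟩⟩
      rw [Scheme.IdealSheafData.ideal_bot, Pi.bot_apply, eq_comm, Ideal.span_singleton_eq_bot] at hfU
      rw [hfU] at hf
      exact zero_notMem_nonZeroDivisors hf
    haveI : IsIntegral X₂ := hτ.isIntegral hC
    -- the generic point of `X₁` maps to the generic point of `P`
    have hη₁ : σ₁ (genericPoint X₁) = genericPoint P := by
      have h1 : σ₁ x ∈ closure ({σ₁ (genericPoint X₁)} : Set P) := by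
        have hxcl : x ∈ closure ({genericPoint X₁} : Set X₁) := by
          rw [genericPoint_closure]; trivial
        exact image_closure_subset_closure_image σ₁.continuous ⟨x, hxcl, rfl⟩ |> fun h => by
          rwa [Set.image_singleton] at h
      rw [hx, ← specializes_iff_mem_closure] at h1
      exact (h1.antisymm ((genericPoint_spec P).specializes (Set.mem_univ _))).eq
    -- it lies off the centre, where the blow-up is an isomorphism: lift it to `X₂`
    have hηC : genericPoint X₁ ∈ centreCompl C := not_mem_support_genericPoint hC
    haveI : IsIso (τ ∣_ centreCompl C) := hτ.isIso_compl
    obtain ⟨z, hz⟩ := (τ ∣_ centreCompl C).surjective ⟨genericPoint X₁, hηC⟩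
    have hτz : τ z.1 = genericPoint X₁ := by
      have h := morphismRestrict_base_coe τ (centreCompl C) z
      rw [hz] at h
      exact h.symm
    refine ⟨hch₂, inferInstance, z.1, ?_⟩
    rw [Scheme.Hom.comp_apply, hτz, hη₁]

/-- **Stages of an item chain dominate the base**: if `q (genericPoint P) ≠ s₀` then some point of the stage maps outside `s₀`
under `σ ≫ q` (for `P = ℙⁿ_O → Spec O`: a point of the generic fibre — the horizontality input of the multisection adapter).
[folklore] -/
theorem chain_exists_apply_ne {P : Scheme.{0}} [IsIntegral P] {Y : Set P} {ξ : P} (hξ : IsGenericPoint ξ Y)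
    {S : Scheme.{0}} (q : P ⟶ S) {s₀ : S} (hq : q (genericPoint P) ≠ s₀)
    {X' : Scheme.{0}} {σ : X' ⟶ P} {S' : Set X'} (h : Chain P Y X' σ S') :
    ∃ x : X', (σ ≫ q) x ≠ s₀ := by
  obtain ⟨-, x, hx⟩ := chain_isIntegral_and_exists_over_genericPoint hξ h
  exact ⟨x, by rwa [Scheme.Hom.comp_apply, hx]⟩

/-- Stages of an item chain over an integral `P` are integral. [cite: StacksProject, Tag 02ND] -/
theorem chain_isIntegral {P : Scheme.{0}} [IsIntegral P] {Y : Set P} {ξ : P} (hξ : IsGenericPoint ξ Y)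
    {X' : Scheme.{0}} {σ : X' ⟶ P} {S' : Set X'} (h : Chain P Y X' σ S') : IsIntegral X' :=
  (chain_isIntegral_and_exists_over_genericPoint hξ h).1

end Summit.ResolutionOfSingularities.ResolutionOfSingularities.Cruxes.EquisingularLiftNat.Sections

end
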